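import Summits.CriticalPhenomena.PercolationContinuityZ3.Theses.PercBurnResprinkle
import Summits.CriticalPhenomena.PercolationContinuityZ3.Theorems.PercBurnResprinkleVacantReignitionDuality
import Literature.Probability.Percolation.PercolationProofs
import Literature.Probability.Percolation.StaticRenormalizationBlocks
import Literature.Probability.Percolation.BondPercolationSymmetry
import Literature.Probability.LatticeModels.StarBoundary
import HarnessLib
import Literature.Probability.Percolation.SiteCrossingDuality
import Literature.Probability.Percolation.LatticeSymmetry

/-!
# Crux `PercBurnResprinkle.VacantReignition` (stmt-CriticalPhenomena-7203), line `slab-slice-avoidability` — stub `stub_dualityCurtain`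

(worker of lead prover-line-stmt-CriticalPhenomena-7203-c2-0; registered stub of the skeleton
`Cruxes/VacantReignition/Lines/slab_slice_avoidability.lean`, statement DEF-FREE over tree
vocabulary.)

## What is proved

The deterministic duality step of the static renormalisation of Ahlberg–Duminil-Copin–Kozma–
Sidoravicius (arXiv:1302.6872, §2, p. 6, step 1) at `d = 3`, in its CURTAIN form.  Blocks of the
layer `{x₀ = 0}` of `ℤ³` are indexed by `z ∈ ℤ²` (`ι z = (0, z₀, z₁)`, scale `L`, window radius
`blockR L k`); a block is VG if its window misses the infinite clusters of the environment
`η_p(π.1)` (VACANT) and the fresh field `η_q(π.2)` satisfies the (8.90)-type good event seen from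
the block (GOOD).  For a coarse site `x ∈ ℤ²` (`k + 3 ≤ S`) and a density `κ`: if the environment
is CURTAIN-OK around `x` (every self-avoiding `★`-chain `γ` of the region `{z | |z_i - S x_i| ≤ 3S}`
of extent `≥ S` carries a set `F ⊆ γ` of UNTOUCHED blocks with `κ |γ| ≤ #F`) and the fresh field
is not NECKLACE-BAD around `x` (no such chain carries a set `F ⊆ γ` of non-GOOD blocks with
`κ |γ| ≤ #F`), then both rectangles `H(x) = [Sx₀-S, Sx₀+2S] × [Sx₁, Sx₁+S]` and
`V(x) = [Sx₀, Sx₀+S] × [Sx₁-S, Sx₁+2S]` are crossed the long way by nearest-neighbour walks of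
`ℤ²` of VG blocks (`Theorems.stub_dualityCurtain`, the registered signature verbatim).

## Proof

Planar site duality (`plusLRCrossing_or_minusStarTBCrossing`, Kesten 1982 Prop. 2.2) on the
`3S × S` rectangle with the colouring "VG after an automorphism `f` of `ℤ²`" (`f` = translation
`zdShiftIso` for `H(x)`, transposition `transposeIso` followed by a translation for `V(x)`):
either a left-right lattice walk of VG sites, whose image under `f` is the wanted crossing, or a
top-bottom `★`-walk `q` of non-VG sites.  In the second case the loop-erasure `q.bypass` of `q`
(`SimpleGraph.Walk.bypass`, a path with the same endpoints and smaller support) is mapped by the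
injective `★`-compatible `f` to a self-avoiding `zdStar 2`-chain `γ` of the region of extent
`≥ S` (`List.Nodup.map`, `List.isChain_map_of_isChain`); CURTAIN-OK supplies `F ⊆ γ` of
UNTOUCHED blocks with `κ |γ| ≤ #F`; every block of `γ` is non-VG, and a non-VG GOOD block is
non-VACANT hence TOUCHED (`vacantReignition_du_touched`: an infinite cluster meeting the window
has, seen from the block, an arm to distance `S(2L+1) > blockR L k`), so the blocks of `F` are
non-GOOD and `(γ, F)` is a NECKLACE-BAD witness, a contradiction.

Sources: D. Ahlberg, H. Duminil-Copin, G. Kozma, V. Sidoravicius, *Seven-dimensional forest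
fires*, AIHP 51 (2015), §2 [AhlbergEtAl2015]; H. Kesten, *Percolation theory for
mathematicians* (1982), Prop. 2.2 (matching-pair duality) [Kesten1982]; G. Grimmett,
*Percolation* (1999), §7.4 (arm events) [GrimmettPercolation1999].  No new definitions; the
helper lemmas (`vacantReignition_duc_*`) are stated over abstract block predicates and
specialised only in the final theorem; the `vacantReignition_du_*` lemmas of the landed
`…Duality.lean` are reused.
-/

noncomputable section

namespace Summit.CriticalPhenomena.PercolationContinuityZ3.Theorems

open Literature.Probability.Percolation Literature.Probability.LatticeModels

/-! ### The dual case: a closed `★`-crossing is a NECKLACE-BAD witness -/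

/-- **A closed `★`-crossing is a NECKLACE-BAD witness.**  Abstract block predicates `VG`, `GOOD`,
`TOUCHED` on `ℤ²` with "not VG and GOOD ⇒ TOUCHED"; if the environment is CURTAIN-OK around the
coarse site `x` (every self-avoiding `★`-chain `γ` of the region of extent `≥ S` carries
`F ⊆ γ` of non-TOUCHED sites with `κ |γ| ≤ #F`), then from a walk `q` of non-VG sites inside the
region whose endpoints are sent `S` apart by an injective `★`-compatible map `f` one gets a
NECKLACE-BAD witness: the image `γ` of the loop-erasure `q.bypass` is a self-avoiding `★`-chain of
the region of extent `≥ S`, and the set `F` supplied by CURTAIN-OK consists of non-VG non-TOUCHED,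
hence non-GOOD, sites. [cite: AhlbergEtAl2015, §2] -/
theorem vacantReignition_duc_necklace {S : ℕ} {κ : ℝ} {x : Fin 2 → ℤ} {VG GOOD TOUCHED : (Fin 2 → ℤ) → Prop}
    (hVT : ∀ z, ¬ VG z → GOOD z → TOUCHED z)
    (hC : ∀ γ : List (Fin 2 → ℤ), γ.Nodup → List.IsChain (fun a b => (zdStar 2).Adj a b) γ →
        (∀ z ∈ γ, (∀ i, |z i - (S : ℤ) * x i| ≤ 3 * (S : ℤ))) →
        (∃ z ∈ γ, ∃ z' ∈ γ, ∃ i, (S : ℤ) ≤ |z i - z' i|) →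
        ∃ F : Finset (Fin 2 → ℤ), (∀ z ∈ F, z ∈ γ ∧ ¬ TOUCHED z) ∧ κ * (γ.length : ℝ) ≤ (F.card : ℝ))
    {V : Type*} {G : SimpleGraph V} (f : V → (Fin 2 → ℤ))
    (hf : ∀ a b, G.Adj a b → (zdStar 2).Adj (f a) (f b)) (hfi : Function.Injective f)
    {t b : V} (q : G.Walk t b)
    (hq : ∀ z ∈ q.support, (∀ i, |f z i - (S : ℤ) * x i| ≤ 3 * (S : ℤ)) ∧ ¬ VG (f z))
    (hext : ∃ i, (S : ℤ) ≤ |f t i - f b i|) :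
    ∃ γ : List (Fin 2 → ℤ), γ.Nodup ∧ List.IsChain (fun a b => (zdStar 2).Adj a b) γ ∧
      (∀ z ∈ γ, (∀ i, |z i - (S : ℤ) * x i| ≤ 3 * (S : ℤ))) ∧
      (∃ z ∈ γ, ∃ z' ∈ γ, ∃ i, (S : ℤ) ≤ |z i - z' i|) ∧
      ∃ F : Finset (Fin 2 → ℤ), (∀ z ∈ F, z ∈ γ ∧ ¬ GOOD z) ∧ κ * (γ.length : ℝ) ≤ (F.card : ℝ) := by
  classical
  have hmem : ∀ z, z ∈ q.bypass.support.map f ↔ ∃ z' ∈ q.bypass.support, f z' = z := fun z =>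
    List.mem_map
  have hnd : (q.bypass.support.map f).Nodup := List.Nodup.map hfi q.bypass_isPath.support_nodup
  have hch : List.IsChain (fun a b => (zdStar 2).Adj a b) (q.bypass.support.map f) :=
    List.isChain_map_of_isChain f (fun a b h => hf a b h) q.bypass.isChain_adj_support
  have hreg : ∀ z ∈ q.bypass.support.map f, ∀ i, |z i - (S : ℤ) * x i| ≤ 3 * (S : ℤ) := by
    intro z hz
    obtain ⟨z', hz', rfl⟩ := (hmem z).1 hz
    exact (hq z' (q.support_bypass_subset_support hz')).1
  have hex : ∃ z ∈ q.bypass.support.map f, ∃ z' ∈ q.bypass.support.map f, ∃ i, (S : ℤ) ≤ |z i - z' i| :=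
    ⟨f t, (hmem _).2 ⟨t, q.bypass.start_mem_support, rfl⟩,
      f b, (hmem _).2 ⟨b, q.bypass.end_mem_support, rfl⟩, hext⟩
  obtain ⟨F, hF, hκ⟩ := hC _ hnd hch hreg hex
  refine ⟨q.bypass.support.map f, hnd, hch, hreg, hex, F,
    fun z hz => ⟨(hF z hz).1, fun hg => (hF z hz).2 ?_⟩, hκ⟩
  obtain ⟨z', hz', hzz'⟩ := (hmem z).1 (hF z hz).1
  rw [← hzz'] at hg ⊢
  exact hVT _ (hq z' (q.support_bypass_subset_support hz')).2 hg

/-! ### Duality on one rectangle -/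

/-- **Duality on one rectangle (curtain form).**  With the abstract predicates of
`vacantReignition_duc_necklace`, CURTAIN-OK and not NECKLACE-BAD: for an injective endomorphism
`f` of the square lattice that sends `★`-steps to `★`-steps and maps the rectangle
`[0, m] × [0, n]` (`m ≥ 1`) into the region of `x` and into the target set `Rect`, its left/right
sides into `Pa`/`Pb`, and its top and bottom sides `S` apart, there is a lattice walk of VG sites
of `Rect` from `Pa` to `Pb`: by the matching-pair duality of site percolation
(`plusLRCrossing_or_minusStarTBCrossing`, Kesten 1982, Prop. 2.2) applied to the colouring
`VG ∘ f`, the alternative being a NECKLACE-BAD witness. [cite: Kesten1982, Prop. 2.2] -/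
theorem vacantReignition_duc_generic {S : ℕ} {κ : ℝ} {x : Fin 2 → ℤ} {VG GOOD TOUCHED Rect Pa Pb : (Fin 2 → ℤ) → Prop}
    (hC : ∀ γ : List (Fin 2 → ℤ), γ.Nodup → List.IsChain (fun a b => (zdStar 2).Adj a b) γ →
        (∀ z ∈ γ, (∀ i, |z i - (S : ℤ) * x i| ≤ 3 * (S : ℤ))) →
        (∃ z ∈ γ, ∃ z' ∈ γ, ∃ i, (S : ℤ) ≤ |z i - z' i|) →
        ∃ F : Finset (Fin 2 → ℤ), (∀ z ∈ F, z ∈ γ ∧ ¬ TOUCHED z) ∧ κ * (γ.length : ℝ) ≤ (F.card : ℝ))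
    (hN : ¬ (∃ γ : List (Fin 2 → ℤ), γ.Nodup ∧ List.IsChain (fun a b => (zdStar 2).Adj a b) γ ∧
      (∀ z ∈ γ, (∀ i, |z i - (S : ℤ) * x i| ≤ 3 * (S : ℤ))) ∧
      (∃ z ∈ γ, ∃ z' ∈ γ, ∃ i, (S : ℤ) ≤ |z i - z' i|) ∧
      ∃ F : Finset (Fin 2 → ℤ), (∀ z ∈ F, z ∈ γ ∧ ¬ GOOD z) ∧ κ * (γ.length : ℝ) ≤ (F.card : ℝ)))
    (m n : ℕ) (hm : 1 ≤ m) (f : zdGraph 2 →g zdGraph 2)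
    (hfS : ∀ a b, zdStarGraph.Adj a b → (zdStar 2).Adj (f a) (f b)) (hfi : Function.Injective f)
    (hRect : ∀ z ∈ rectangle m n, Rect (f z))
    (hReg : ∀ z ∈ rectangle m n, ∀ i, |f z i - (S : ℤ) * x i| ≤ 3 * (S : ℤ))
    (hPa : ∀ z ∈ leftSide m n, Pa (f z)) (hPb : ∀ z ∈ rightSide m n, Pb (f z))
    (hext : ∀ z ∈ topSide m n, ∀ z' ∈ bottomSide m n, ∃ i, (S : ℤ) ≤ |f z i - f z' i|)
    (hVT : ∀ z, ¬ VG z → GOOD z → TOUCHED z) :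
    ∃ a b : Fin 2 → ℤ, Pa a ∧ Pb b ∧ ∃ P : (zdGraph 2).Walk a b, ∀ z ∈ P.support, Rect z ∧ VG z := by
  rcases plusLRCrossing_or_minusStarTBCrossing (fun z => VG (f z)) hm n with
    ⟨x', hx', y', hy', P, hP⟩ | ⟨t, ht, b, hb, q, hq⟩
  · refine ⟨f x', f y', hPa x' hx', hPb y' hy', P.map f, fun z hz => ?_⟩
    rw [SimpleGraph.Walk.support_map, List.mem_map] at hz
    obtain ⟨z', hz', rfl⟩ := hz
    exact ⟨hRect z' (hP z' hz').1, (hP z' hz').2⟩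
  · exact absurd (vacantReignition_duc_necklace hVT hC f hfS hfi q
      (fun z hz => ⟨hReg z (hq z hz).1, (hq z hz).2⟩) (hext t ht b hb)) hN

/-! ### The registered stub -/

/-- **Duality step of the ADKS static renormalisation (curtain form, slab-slice avoidability).**
For `k + 3 ≤ S`, a density `κ`, levels `p, q`, a coarse site `x ∈ ℤ²` and a pair of label fields
`π = (U, U')`: if the environment is CURTAIN-OK around `x` (every self-avoiding `★`-chain `γ` of
blocks `ι z`, `|z_i - S x_i| ≤ 3S`, of extent `≥ S` carries `F ⊆ γ` of UNTOUCHED blocks with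
`κ |γ| ≤ #F`) and the fresh field is not NECKLACE-BAD around `x`, then both rectangles
`H(x) = [Sx₀-S, Sx₀+2S] × [Sx₁, Sx₁+S]` and `V(x) = [Sx₀, Sx₀+S] × [Sx₁-S, Sx₁+2S]` are crossed
the long way by nearest-neighbour walks of `ℤ²` all of whose blocks are VACANT (the window misses
the infinite clusters of `η_p(U)`) and GOOD (the (8.90)-type good event of `η_q(U')` seen from
the block).  Proof: `vacantReignition_duc_generic` for the translation by `(Sx₀-S, Sx₁)` resp.
the transposition followed by the translation by `(Sx₀, Sx₁-S)` (both injective), with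
`vacantReignition_du_touched` supplying "not VACANT ⇒ TOUCHED". [cite: AhlbergEtAl2015, §2] -/
theorem stub_dualityCurtain :
    ∀ k S L : ℕ, k + 3 ≤ S → ∀ (κ p q : ℝ) (x : Fin 2 → ℤ) (π : (Sym2 (Fin 3 → ℤ) → ℝ) × (Sym2 (Fin 3 → ℤ) → ℝ)),
      (∀ γ : List (Fin 2 → ℤ), γ.Nodup → List.IsChain (fun a b => (zdStar 2).Adj a b) γ → (∀ z ∈ γ, (∀ i, |z i - (S : ℤ) * x i| ≤ 3 * (S : ℤ))) → (∃ z ∈ γ, ∃ z' ∈ γ, ∃ i, (S : ℤ) ≤ |z i - z' i|) → ∃ F : Finset (Fin 2 → ℤ), (∀ z ∈ F, z ∈ γ ∧ ¬ (∃ y ∈ (↑(box 3 (blockR L k)) : Set (Fin 3 → ℤ)), BondConfig.relabel (sym2Equiv (Site.shift (-(((2 * L + 1 : ℕ) : ℤ) • (![0, z 0, z 1] : Fin 3 → ℤ))))) (configOfLabels p π.1 (zdGraph 3)) ∈ boxArm (S * (2 * L + 1)) y)) ∧ κ * (γ.length : ℝ) ≤ (F.card : ℝ)) →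
      ¬ (∃ γ : List (Fin 2 → ℤ), γ.Nodup ∧ List.IsChain (fun a b => (zdStar 2).Adj a b) γ ∧ (∀ z ∈ γ, (∀ i, |z i - (S : ℤ) * x i| ≤ 3 * (S : ℤ))) ∧ (∃ z ∈ γ, ∃ z' ∈ γ, ∃ i, (S : ℤ) ≤ |z i - z' i|) ∧ ∃ F : Finset (Fin 2 → ℤ), (∀ z ∈ F, z ∈ γ ∧ ¬ ((∃ w ∈ (↑(box 3 L) : Set (Fin 3 → ℤ)), BondConfig.relabel (sym2Equiv (Site.shift (-(((2 * L + 1 : ℕ) : ℤ) • (![0, z 0, z 1] : Fin 3 → ℤ))))) (configOfLabels q π.2 (zdGraph 3)) ∈ boxArm (blockR L k + (2 * L + 1)) w) ∧ ∀ u ∈ (↑(box 3 (3 * L + 1)) : Set (Fin 3 → ℤ)), ∀ v ∈ (↑(box 3 (3 * L + 1)) : Set (Fin 3 → ℤ)), BondConfig.relabel (sym2Equiv (Site.shift (-(((2 * L + 1 : ℕ) : ℤ) • (![0, z 0, z 1] : Fin 3 → ℤ))))) (configOfLabels q π.2 (zdGraph 3)) ∉ twoArm (blockR L k) u v)) ∧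 κ * (γ.length : ℝ) ≤ (F.card : ℝ)) →
      ((∃ a b : Fin 2 → ℤ, a 0 = (S : ℤ) * x 0 - S ∧ b 0 = (S : ℤ) * x 0 + 2 * S ∧ ∃ P : (zdGraph 2).Walk a b, ∀ z ∈ P.support, ((S : ℤ) * x 0 - S ≤ z 0 ∧ z 0 ≤ (S : ℤ) * x 0 + 2 * S ∧ (S : ℤ) * x 1 ≤ z 1 ∧ z 1 ≤ (S : ℤ) * x 1 + S) ∧ (∀ y ∈ (↑(box 3 (blockR L k)) : Set (Fin 3 → ℤ)), ¬ (openCluster (configOfLabels p π.1 (zdGraph 3)) (((2 * L + 1 : ℕ) : ℤ) • (![0, z 0, z 1] : Fin 3 → ℤ) + y)).Infinite) ∧ ((∃ w ∈ (↑(box 3 L) : Set (Fin 3 → ℤ)), BondConfig.relabel (sym2Equiv (Site.shift (-(((2 * L + 1 : ℕ) : ℤ) • (![0, z 0, z 1] : Fin 3 → ℤ))))) (configOfLabels q π.2 (zdGraph 3)) ∈ boxArm (blockR L k + (2 * L + 1)) w) ∧ ∀ u ∈ (↑(box 3 (3 * L + 1)) : Set (Fin 3 → ℤ)), ∀ v ∈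 (↑(box 3 (3 * L + 1)) : Set (Fin 3 → ℤ)), BondConfig.relabel (sym2Equiv (Site.shift (-(((2 * L + 1 : ℕ) : ℤ) • (![0, z 0, z 1] : Fin 3 → ℤ))))) (configOfLabels q π.2 (zdGraph 3)) ∉ twoArm (blockR L k) u v)) ∧ (∃ a b : Fin 2 → ℤ, a 1 = (S : ℤ) * x 1 - S ∧ b 1 = (S : ℤ) * x 1 + 2 * S ∧ ∃ P : (zdGraph 2).Walk a b, ∀ z ∈ P.support, ((S : ℤ) * x 0 ≤ z 0 ∧ z 0 ≤ (S : ℤ) * x 0 + S ∧ (S : ℤ) * x 1 - S ≤ z 1 ∧ z 1 ≤ (S : ℤ) * x 1 + 2 * S) ∧ (∀ y ∈ (↑(box 3 (blockR L k)) : Set (Fin 3 → ℤ)), ¬ (openCluster (configOfLabels p π.1 (zdGraph 3)) (((2 * L + 1 : ℕ) : ℤ) • (![0, z 0, z 1] : Fin 3 → ℤ) + y)).Infinite) ∧ ((∃ w ∈ (↑(box 3 L) : Set (Fin 3 → ℤ)), BondConfig.relabel (sym2Equiv (Site.shift (-(((2 * L + 1 : ℕ) : ℤ) • (![0, z 0,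 z 1] : Fin 3 → ℤ))))) (configOfLabels q π.2 (zdGraph 3)) ∈ boxArm (blockR L k + (2 * L + 1)) w) ∧ ∀ u ∈ (↑(box 3 (3 * L + 1)) : Set (Fin 3 → ℤ)), ∀ v ∈ (↑(box 3 (3 * L + 1)) : Set (Fin 3 → ℤ)), BondConfig.relabel (sym2Equiv (Site.shift (-(((2 * L + 1 : ℕ) : ℤ) • (![0, z 0, z 1] : Fin 3 → ℤ))))) (configOfLabels q π.2 (zdGraph 3)) ∉ twoArm (blockR L k) u v))) := by
  intro k S L hkS κ p q x π hC hN
  have hm : 1 ≤ 3 * S := by omega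
  constructor
  · -- the horizontal rectangle `H(x)`: translate `[0, 3S] × [0, S]` by `(Sx₀ - S, Sx₁)`
    obtain ⟨f, hf⟩ : ∃ f : zdGraph 2 →g zdGraph 2,
        ∀ z, f z = z + (![(S : ℤ) * x 0 - S, (S : ℤ) * x 1] : Fin 2 → ℤ) :=
      ⟨(zdShiftIso _).toHom, fun _ => rfl⟩
    have hf0 : ∀ z, f z 0 = z 0 + ((S : ℤ) * x 0 - S) := fun z => by rw [hf]; rfl
    have hf1 : ∀ z, f z 1 = z 1 + (S : ℤ) * x 1 := fun z => by rw [hf]; rfl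
    have hfi : Function.Injective f := fun a b h => by
      have h0 := congrFun h 0
      have h1 := congrFun h 1
      rw [hf0, hf0] at h0
      rw [hf1, hf1] at h1
      exact funext (Fin.forall_fin_two.2 ⟨by omega, by omega⟩)
    refine vacantReignition_duc_generic hC hN (3 * S) S hm f ?_ hfi ?_ ?_ ?_ ?_ ?_ ?_
    · intro a b h
      rw [zdStarGraph_adj_iff] at h
      obtain ⟨hne, h0, h1⟩ := h
      refine vacantReignition_du_zdStar_adj_of_coord ?_ ?_ ?_
      · rw [hf0, hf0, hf1, hf1]; rcases hne with h | h <;> omega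
      · rw [hf0, hf0, add_sub_add_right_eq_sub]; exact h0
      · rw [hf1, hf1, add_sub_add_right_eq_sub]; exact h1
    · intro z hz
      rw [mem_rectangle_iff] at hz
      rw [hf0, hf1]; omega
    · intro z hz
      rw [mem_rectangle_iff] at hz
      rw [Fin.forall_fin_two, hf0, hf1, abs_le, abs_le]; omega
    · intro z hz
      have h := (Finset.mem_filter.1 hz).2
      rw [hf0, h]; omega
    · intro z hz
      have h := (Finset.mem_filter.1 hz).2
      rw [hf0, h]; omega
    · intro z hz z' hz'
      have h := (Finset.mem_filter.1 hz).2
      have h' := (Finset.mem_filter.1 hz').2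
      refine ⟨1, le_abs.2 (Or.inl ?_)⟩
      rw [hf1, hf1, h, h']; omega
    · intro z h hg
      exact vacantReignition_du_touched hkS _ fun hv => h ⟨hv, hg⟩
  · -- the vertical rectangle `V(x)`: transpose `[0, 3S] × [0, S]`, then translate by `(Sx₀, Sx₁ - S)`
    obtain ⟨f, hf⟩ : ∃ f : zdGraph 2 →g zdGraph 2,
        ∀ z, f z = transposeIso z + (![(S : ℤ) * x 0, (S : ℤ) * x 1 - S] : Fin 2 → ℤ) :=
      ⟨(zdShiftIso _).toHom.comp transposeIso.toHom, fun _ => rfl⟩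
    have hf0 : ∀ z, f z 0 = z 1 + (S : ℤ) * x 0 := fun z => by
      rw [hf, Pi.add_apply, transposeIso_apply_zero]; rfl
    have hf1 : ∀ z, f z 1 = z 0 + ((S : ℤ) * x 1 - S) := fun z => by
      rw [hf, Pi.add_apply, transposeIso_apply_one]; rfl
    have hfi : Function.Injective f := fun a b h => by
      have h0 := congrFun h 0
      have h1 := congrFun h 1
      rw [hf0, hf0] at h0
      rw [hf1, hf1] at h1
      exact funext (Fin.forall_fin_two.2 ⟨by omega, by omega⟩)
    refine vacantReignition_duc_generic hC hN (3 * S) S hm f ?_ hfi ?_ ?_ ?_ ?_ ?_ ?_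
    · intro a b h
      rw [zdStarGraph_adj_iff] at h
      obtain ⟨hne, h0, h1⟩ := h
      refine vacantReignition_du_zdStar_adj_of_coord ?_ ?_ ?_
      · rw [hf0, hf0, hf1, hf1]; rcases hne with h | h <;> omega
      · rw [hf0, hf0, add_sub_add_right_eq_sub]; exact h1
      · rw [hf1, hf1, add_sub_add_right_eq_sub]; exact h0
    · intro z hz
      rw [mem_rectangle_iff] at hz
      rw [hf0, hf1]; omega
    · intro z hz
      rw [mem_rectangle_iff] at hz
      rw [Fin.forall_fin_two, hf0, hf1, abs_le, abs_le]; omega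
    · intro z hz
      have h := (Finset.mem_filter.1 hz).2
      rw [hf1, h]; omega
    · intro z hz
      have h := (Finset.mem_filter.1 hz).2
      rw [hf1, h]; omega
    · intro z hz z' hz'
      have h := (Finset.mem_filter.1 hz).2
      have h' := (Finset.mem_filter.1 hz').2
      refine ⟨0, le_abs.2 (Or.inl ?_)⟩
      rw [hf0, hf0, h, h']; omega
    · intro z h hg
      exact vacantReignition_du_touched hkS _ fun hv => h ⟨hv, hg⟩

end Summit.CriticalPhenomena.PercolationContinuityZ3.Theorems

end
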